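import Summits.ResolutionOfSingularities.ResolutionOfSingularities.Theorems.WeightedInvariantIota3DropCurveDatum
import HarnessLib

/-!
# The gap list of `stub_keyRungGrHomLE_three` cut to hD + (D-b³-point) + (D-b³-curve-TIE): tie-free curve centres are settled
# (door `HypersurfaceCentreConstruction`, stmt-ResolutionOfSingularities-19897)

Helper for `stub_keyRungGrHomLE_three` (def-free, `--supports 19897`).  Sequel of …Iota3DropCurveDatum (the `S`-side integer-contact
datum `(y, x, z; b; ν)` at a curve centre: `(y, x) = P`, `J₃ᵗ = 𝒥((y, x); (b, 1))`, `f ∈ 𝒥_{bν} ∩ 𝔪^ν ∖ 𝔪^{ν+1}`) and of hand -7's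
…Iota3DropCurveB / …KeyRungThreeOfDropB3 ((DROP)₃ = TYPE (a) ✓ + (D-div) ✓ + (D-b³); (D-b³-curve) ⟸ a TIE-FREE datum).

* **`Iota3.dropb3_of_point_curveTie`** — (D-b³) ⟸ (D-b³-point) + (D-b³-curve-TIE): at a curve centre the datum is either tie-free —
  ORDER drop at every successor over the closed point (`Iota3.dropb3_curve_of_tieFree_datum`, weights `(b, 1)`, …P3aTieFreeDrop) — or
  TIED: `f ∈ 𝒥_{(b+1)ν}((x, y − λx^b, z); (1, b+1, 1))` for some `λ ∈ S`, or `b = 1` and `f ∈ 𝒥_{2ν}((y, x, z); (1, 2, 1))`.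
* **`Iota3.canonicalGameClauseHomLE_three_of_point_curveTie`**, **`keyRungGrHomLE_three_of_tieDescent_point_curveTie`**,
  **`keyRungGrHomLE_three_of_c11_point_curveTie`**, **`pRungGrHomLE_three_of_tieDescent_point_curveTie`** — THE GAP LISTS OF RECORD.

REMARK (why (D-b³-curve-TIE) is not empty and is not an order drop).  `J₃ᵗ` reads the P2 centre `jContact` at `S_P`, whose contact
level `b = b_max ∈ ℕ` is the INTEGER PART of the Abramovich–Quek–Schober slope `r/q` of `f/1`, while the letter `τ` tests the AQS tie
(weights `(q, r+1, 1)` on `(x, y − λx^r, z)`).  When `r/q ∉ ℕ` a `τ = 0` curve centre can carry an integer tie: `f = y² + z x³`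
(`k` perfect, `char k ≠ 2, 3`, `S = k[x, y, z]_{(x, y, z)}`, `P = (y, x)`, `ν = 2`, `b = 1`, AQS slope `3/2`, no AQS tie, `ε = τ = 0` at
`P` and at `𝔪`) has the `t`-homogeneous successor `𝔫 = (t⁻¹, yt, z)` of `B = S[t⁻¹, yt, xt]` over `𝔪` (off the vertex: `xt ∉ 𝔫`), with
`f = (t⁻¹)² g`, `g = (yt)² + z (xt)³ t⁻¹ ∈ 𝔫²`: the ORDER stays `2`; `ε = τ = 0` persist at `B_𝔫` and the drop of `ι₃ᵗ` is carried by
the ratio letter `σ₁` (`3 = 2!·(3/2) ↦ 2 = 2!·1`, the initial form `Y² + ZS` of `g` not being a square).  So (D-b³-curve-TIE) is a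
`σ`-drop statement, as the point regimes are; in characteristic `2` the same happens for `f = y² + x³z + x⁴`.
[OURS · L1 W4.3 · audit glue; AI work, weaker than expert review; nothing here is a statement of the manuscript under review.]

## References

* D. Abramovich, M. H. Quek, B. Schober, arXiv:2507.01232 (2025), Thm 1.3 (3), Thm 3.5. [AbramovichQuekSchober2025]
* V. Cossart, U. Jannsen, S. Saito, LNM 2270 (2020), Ch. 8. [CossartJannsenSaito2020]
-/

noncomputable section

set_option linter.dupNamespace false -- mandated namespace of this single-conjunct summit

open IsLocalRing Literature.AlgebraicGeometry.Resolution
open Summit.ResolutionOfSingularities.ResolutionOfSingularities.Theorems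
open Summit.ResolutionOfSingularities.ResolutionOfSingularities.Theorems.ContactCylinder

namespace Summit.ResolutionOfSingularities.ResolutionOfSingularities.Cruxes.HypersurfaceCentreConstruction.LocalEngine

namespace Iota3

/-! ## The gap lists of record: hD + (D-b³-point) + (D-b³-curve-TIE) -/

/-- **(D-b³) ⟸ (D-b³-point) + (D-b³-curve-TIE).**  At a curve centre (`P ≠ 𝔪`) the integer-contact datum of `exists_curve_datum`
either is TIE-FREE — then `ι₃ᵗ` drops at every successor over the closed point by hand -7's `dropb3_curve_of_tieFree_datum` (ORDER
drop, …P3aTieFreeDrop; weights `(r, q) = (b, 1)`, coprime) — or is TIED, which is the hypothesis `hCURVETIE`; point centres are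
`hPOINT`. [OURS · L1 W4.3 · (D-b³) split] -/
theorem dropb3_of_point_curveTie (p : ℕ)
    (hPOINT : ∀ (k₀ : Type) [Field k₀] [CharP k₀ p] [PerfectField k₀]
      (S : Type) [CommRing S] [Algebra k₀ S] [Algebra.EssFiniteType k₀ S] [IsRegularLocalRing S]
      (f : S), ringKrullDim S = 3 → f ≠ 0 → f ∈ (maximalIdeal S) ^ 2 →
      ∀ (P : Ideal S) [P.IsPrime], IsRegularLocalRing (S ⧸ P) → f ∈ P →
        topStratum iotaOrdEpsTau S f = {𝔮 | P ≤ 𝔮.asIdeal} → ¬ ringKrullDim (Localization.AtPrime P) ≤ 1 →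
        P = maximalIdeal S →
        ∀ (n : ℕ) (u : Fin n → S) (w : Fin n → ℕ),
          Ideal.span (Set.range u) = maximalIdeal S → (maximalIdeal S).spanFinrank = n → (∃ i, 0 < w i) →
          Ideal.span {x | ∃ i, 0 < w i ∧ x = u i} = P →
          (∀ m : ℕ, weightedMonomialIdeal u w m = jFlatT S f m) →
          ∀ (𝔫 : Ideal (cobordantAlgebra' u w)) [𝔫.IsPrime], IsTHomogeneous u w 𝔫 → cobordantT' u w ∈ 𝔫 →
            (maximalIdeal S).map (algebraMap S (cobordantAlgebra' u w)) ≤ 𝔫 →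
            ¬ extReesAlgebra.vertexIdeal (weightedMonomialIdeal u w) ≤ 𝔫 →
            ∀ (a : ℕ) (g : cobordantAlgebra' u w), algebraMap S (cobordantAlgebra' u w) f = cobordantT' u w ^ a * g →
              ¬ cobordantT' u w ∣ g →
              algebraMap (cobordantAlgebra' u w) (Localization.AtPrime 𝔫) g ∈ maximalIdeal (Localization.AtPrime 𝔫) ^ 2 →
              iotaFlatT (Localization.AtPrime 𝔫) (algebraMap (cobordantAlgebra' u w) (Localization.AtPrime 𝔫) g) <
                iotaFlatT S f)
    (hCURVETIE : ∀ (k₀ : Type) [Field k₀] [CharP k₀ p] [PerfectField k₀]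
      (S : Type) [CommRing S] [Algebra k₀ S] [Algebra.EssFiniteType k₀ S] [IsRegularLocalRing S]
      (f : S), ringKrullDim S = 3 → f ≠ 0 → f ∈ (maximalIdeal S) ^ 2 →
      ∀ (P : Ideal S) [P.IsPrime], IsRegularLocalRing (S ⧸ P) → f ∈ P →
        topStratum iotaOrdEpsTau S f = {𝔮 | P ≤ 𝔮.asIdeal} → ¬ ringKrullDim (Localization.AtPrime P) ≤ 1 →
        P ≠ maximalIdeal S →
        ∀ (y x z : S) (b ν : ℕ), Ideal.span (Set.range ![y, x, z]) = maximalIdeal S → Ideal.span (Set.range ![y, x]) = P →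
          1 ≤ b → 1 ≤ ν → f ∈ maximalIdeal S ^ ν → f ∉ maximalIdeal S ^ (ν + 1) →
          f ∈ weightedMonomialIdeal ![y, x] ![b, 1] (b * ν) → (∀ m : ℕ, jFlatT S f m = weightedMonomialIdeal ![y, x] ![b, 1] m) →
          ((∃ lam : S, f ∈ weightedMonomialIdeal ![x, y - lam * x ^ b, z] ![1, b + 1, 1] ((b + 1) * ν)) ∨
            (b = 1 ∧ f ∈ weightedMonomialIdeal ![y, x, z] ![1, 2, 1] (2 * ν))) →
        ∀ (n : ℕ) (u : Fin n → S) (w : Fin n → ℕ),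
          Ideal.span (Set.range u) = maximalIdeal S → (maximalIdeal S).spanFinrank = n → (∃ i, 0 < w i) →
          Ideal.span {x | ∃ i, 0 < w i ∧ x = u i} = P →
          (∀ m : ℕ, weightedMonomialIdeal u w m = jFlatT S f m) →
          ∀ (𝔫 : Ideal (cobordantAlgebra' u w)) [𝔫.IsPrime], IsTHomogeneous u w 𝔫 → cobordantT' u w ∈ 𝔫 →
            (maximalIdeal S).map (algebraMap S (cobordantAlgebra' u w)) ≤ 𝔫 →
            ¬ extReesAlgebra.vertexIdeal (weightedMonomialIdeal u w) ≤ 𝔫 →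
            ∀ (a : ℕ) (g : cobordantAlgebra' u w), algebraMap S (cobordantAlgebra' u w) f = cobordantT' u w ^ a * g →
              ¬ cobordantT' u w ∣ g →
              algebraMap (cobordantAlgebra' u w) (Localization.AtPrime 𝔫) g ∈ maximalIdeal (Localization.AtPrime 𝔫) ^ 2 →
              iotaFlatT (Localization.AtPrime 𝔫) (algebraMap (cobordantAlgebra' u w) (Localization.AtPrime 𝔫) g) <
                iotaFlatT S f) :
    ∀ (k₀ : Type) [Field k₀] [CharP k₀ p] [PerfectField k₀]
      (S : Type) [CommRing S] [Algebra k₀ S] [Algebra.EssFiniteType k₀ S] [IsRegularLocalRing S]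
      (f : S), ringKrullDim S = 3 → f ≠ 0 → f ∈ (maximalIdeal S) ^ 2 →
      ∀ (P : Ideal S) [P.IsPrime], IsRegularLocalRing (S ⧸ P) → f ∈ P →
        topStratum iotaOrdEpsTau S f = {𝔮 | P ≤ 𝔮.asIdeal} → ¬ ringKrullDim (Localization.AtPrime P) ≤ 1 →
        ∀ (n : ℕ) (u : Fin n → S) (w : Fin n → ℕ),
          Ideal.span (Set.range u) = maximalIdeal S → (maximalIdeal S).spanFinrank = n → (∃ i, 0 < w i) →
          Ideal.span {x | ∃ i, 0 < w i ∧ x = u i} = P →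
          (∀ m : ℕ, weightedMonomialIdeal u w m = jFlatT S f m) →
          ∀ (𝔫 : Ideal (cobordantAlgebra' u w)) [𝔫.IsPrime], IsTHomogeneous u w 𝔫 → cobordantT' u w ∈ 𝔫 →
            (maximalIdeal S).map (algebraMap S (cobordantAlgebra' u w)) ≤ 𝔫 →
            ¬ extReesAlgebra.vertexIdeal (weightedMonomialIdeal u w) ≤ 𝔫 →
            ∀ (a : ℕ) (g : cobordantAlgebra' u w), algebraMap S (cobordantAlgebra' u w) f = cobordantT' u w ^ a * g →
              ¬ cobordantT' u w ∣ g →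
              algebraMap (cobordantAlgebra' u w) (Localization.AtPrime 𝔫) g ∈ maximalIdeal (Localization.AtPrime 𝔫) ^ 2 →
              iotaFlatT (Localization.AtPrime 𝔫) (algebraMap (cobordantAlgebra' u w) (Localization.AtPrime 𝔫) g) <
                iotaFlatT S f := by
  intro k₀ _ _ _ S _ _ _ _ f hd hf0 hf2 P _ hreg hfP hE hP1 n u w h1 h2 h3 h4 h5
  by_cases hPm : P = maximalIdeal S
  · exact hPOINT k₀ S f hd hf0 hf2 P hreg hfP hE hP1 hPm n u w h1 h2 h3 h4 h5
  obtain ⟨y, x, z, b, ν, hyxz, hrk, hyx, hb, hν, hfν, hfν1, hadm, hJ⟩ :=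
    exists_curve_datum k₀ S f hd hf0 (Ideal.pow_le_self two_ne_zero hf2) P hreg hE hP1 hPm
  by_cases htie : (∃ lam : S, f ∈ weightedMonomialIdeal ![x, y - lam * x ^ b, z] ![1, b + 1, 1] ((b + 1) * ν)) ∨
      (b = 1 ∧ f ∈ weightedMonomialIdeal ![y, x, z] ![1, 2, 1] (2 * ν))
  · exact hCURVETIE k₀ S f hd hf0 hf2 P hreg hfP hE hP1 hPm y x z b ν hyxz hyx hb hν hfν hfν1 hadm hJ htie n u w h1 h2 h3 h4 h5
  push Not at htie
  haveI : (Ideal.span (Set.range ![y, x])).IsPrime := by rw [hyx]; infer_instance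
  intro 𝔫 _ hhom hT hM hV a g hfg hTg hg2
  exact dropb3_curve_of_tieFree_datum hyxz hrk Nat.one_pos hb (Nat.coprime_one_right b) hν hfν hfν1 hadm htie.1
    (fun h => htie.2 h.symm) u w (fun m => by rw [h5 m, hJ m]) 𝔫 hhom hT hM hV a g hfg hTg hg2

/-- **hgame ⟸ (D-b³-point) + (D-b³-curve-TIE).** [OURS · L1 W4.3 · audit glue] -/
theorem canonicalGameClauseHomLE_three_of_point_curveTie (p : ℕ)
    (hPOINT : ∀ (k₀ : Type) [Field k₀] [CharP k₀ p] [PerfectField k₀]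
      (S : Type) [CommRing S] [Algebra k₀ S] [Algebra.EssFiniteType k₀ S] [IsRegularLocalRing S]
      (f : S), ringKrullDim S = 3 → f ≠ 0 → f ∈ (maximalIdeal S) ^ 2 →
      ∀ (P : Ideal S) [P.IsPrime], IsRegularLocalRing (S ⧸ P) → f ∈ P →
        topStratum iotaOrdEpsTau S f = {𝔮 | P ≤ 𝔮.asIdeal} → ¬ ringKrullDim (Localization.AtPrime P) ≤ 1 →
        P = maximalIdeal S →
        ∀ (n : ℕ) (u : Fin n → S) (w : Fin n → ℕ),
          Ideal.span (Set.range u) = maximalIdeal S → (maximalIdeal S).spanFinrank = n → (∃ i, 0 < w i) →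
          Ideal.span {x | ∃ i, 0 < w i ∧ x = u i} = P →
          (∀ m : ℕ, weightedMonomialIdeal u w m = jFlatT S f m) →
          ∀ (𝔫 : Ideal (cobordantAlgebra' u w)) [𝔫.IsPrime], IsTHomogeneous u w 𝔫 → cobordantT' u w ∈ 𝔫 →
            (maximalIdeal S).map (algebraMap S (cobordantAlgebra' u w)) ≤ 𝔫 →
            ¬ extReesAlgebra.vertexIdeal (weightedMonomialIdeal u w) ≤ 𝔫 →
            ∀ (a : ℕ) (g : cobordantAlgebra' u w), algebraMap S (cobordantAlgebra' u w) f = cobordantT' u w ^ a * g →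
              ¬ cobordantT' u w ∣ g →
              algebraMap (cobordantAlgebra' u w) (Localization.AtPrime 𝔫) g ∈ maximalIdeal (Localization.AtPrime 𝔫) ^ 2 →
              iotaFlatT (Localization.AtPrime 𝔫) (algebraMap (cobordantAlgebra' u w) (Localization.AtPrime 𝔫) g) <
                iotaFlatT S f)
    (hCURVETIE : ∀ (k₀ : Type) [Field k₀] [CharP k₀ p] [PerfectField k₀]
      (S : Type) [CommRing S] [Algebra k₀ S] [Algebra.EssFiniteType k₀ S] [IsRegularLocalRing S]
      (f : S), ringKrullDim S = 3 → f ≠ 0 → f ∈ (maximalIdeal S) ^ 2 →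
      ∀ (P : Ideal S) [P.IsPrime], IsRegularLocalRing (S ⧸ P) → f ∈ P →
        topStratum iotaOrdEpsTau S f = {𝔮 | P ≤ 𝔮.asIdeal} → ¬ ringKrullDim (Localization.AtPrime P) ≤ 1 →
        P ≠ maximalIdeal S →
        ∀ (y x z : S) (b ν : ℕ), Ideal.span (Set.range ![y, x, z]) = maximalIdeal S → Ideal.span (Set.range ![y, x]) = P →
          1 ≤ b → 1 ≤ ν → f ∈ maximalIdeal S ^ ν → f ∉ maximalIdeal S ^ (ν + 1) →
          f ∈ weightedMonomialIdeal ![y, x] ![b, 1] (b * ν) → (∀ m : ℕ, jFlatT S f m = weightedMonomialIdeal ![y, x] ![b, 1] m) →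
          ((∃ lam : S, f ∈ weightedMonomialIdeal ![x, y - lam * x ^ b, z] ![1, b + 1, 1] ((b + 1) * ν)) ∨
            (b = 1 ∧ f ∈ weightedMonomialIdeal ![y, x, z] ![1, 2, 1] (2 * ν))) →
        ∀ (n : ℕ) (u : Fin n → S) (w : Fin n → ℕ),
          Ideal.span (Set.range u) = maximalIdeal S → (maximalIdeal S).spanFinrank = n → (∃ i, 0 < w i) →
          Ideal.span {x | ∃ i, 0 < w i ∧ x = u i} = P →
          (∀ m : ℕ, weightedMonomialIdeal u w m = jFlatT S f m) →
          ∀ (𝔫 : Ideal (cobordantAlgebra' u w)) [𝔫.IsPrime], IsTHomogeneous u w 𝔫 → cobordantT' u w ∈ 𝔫 →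
            (maximalIdeal S).map (algebraMap S (cobordantAlgebra' u w)) ≤ 𝔫 →
            ¬ extReesAlgebra.vertexIdeal (weightedMonomialIdeal u w) ≤ 𝔫 →
            ∀ (a : ℕ) (g : cobordantAlgebra' u w), algebraMap S (cobordantAlgebra' u w) f = cobordantT' u w ^ a * g →
              ¬ cobordantT' u w ∣ g →
              algebraMap (cobordantAlgebra' u w) (Localization.AtPrime 𝔫) g ∈ maximalIdeal (Localization.AtPrime 𝔫) ^ 2 →
              iotaFlatT (Localization.AtPrime 𝔫) (algebraMap (cobordantAlgebra' u w) (Localization.AtPrime 𝔫) g) <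
                iotaFlatT S f) :
    CanonicalGameClauseHomLE 3 p iotaFlatT jFlatT :=
  canonicalGameClauseHomLE_three_of_dropb3 p (dropb3_of_point_curveTie p hPOINT hCURVETIE)

end Iota3

open Iota3

/-- **GAP LIST OF RECORD for `stub_keyRungGrHomLE_three` — hD + (D-b³-point) + (D-b³-curve-TIE).**  `KeyRungGrHomLE 3 p` from hD
((desc-τ) AS TYPED; TYPING ITEM), (D-b³-point): the `ι₃ᵗ`-drop at the `t`-homogeneous successors over the closed point at POINT centres
(`P = 𝔪`, `dim S = 3`: ISOLATED / TIE / CROSSING), and (D-b³-curve-TIE): the same at CURVE centres carrying a TIED integer-contact datum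
(`f ∈ 𝒥_{(b+1)ν}((x, y − λx^b, z); (1, b+1, 1))` for some `λ`, or `b = 1` and `f ∈ 𝒥_{2ν}((y, x, z); (1, 2, 1))`) — a `σ`-drop statement
(the order need not drop there: module docstring).  Tie-free curve centres are settled. [OURS · L1 W4.3 · audit glue] -/
theorem keyRungGrHomLE_three_of_tieDescent_point_curveTie (p : ℕ)
    (hD : ∀ (T T' : Type) [CommRing T] [IsRegularLocalRing T] [CommRing T'] [IsRegularLocalRing T'] [Algebra T T']
      [IsLocalHom (algebraMap T T')] [Algebra.FormallySmooth T T'] [Algebra.EssFiniteType T T'] (g : T),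
      ringKrullDim T' ≤ 3 → IsTiePosition T' (algebraMap T T' g) → IsTiePosition T g)
    (hPOINT : ∀ (k₀ : Type) [Field k₀] [CharP k₀ p] [PerfectField k₀]
      (S : Type) [CommRing S] [Algebra k₀ S] [Algebra.EssFiniteType k₀ S] [IsRegularLocalRing S]
      (f : S), ringKrullDim S = 3 → f ≠ 0 → f ∈ (maximalIdeal S) ^ 2 →
      ∀ (P : Ideal S) [P.IsPrime], IsRegularLocalRing (S ⧸ P) → f ∈ P →
        topStratum iotaOrdEpsTau S f = {𝔮 | P ≤ 𝔮.asIdeal} → ¬ ringKrullDim (Localization.AtPrime P) ≤ 1 →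
        P = maximalIdeal S →
        ∀ (n : ℕ) (u : Fin n → S) (w : Fin n → ℕ),
          Ideal.span (Set.range u) = maximalIdeal S → (maximalIdeal S).spanFinrank = n → (∃ i, 0 < w i) →
          Ideal.span {x | ∃ i, 0 < w i ∧ x = u i} = P →
          (∀ m : ℕ, weightedMonomialIdeal u w m = jFlatT S f m) →
          ∀ (𝔫 : Ideal (cobordantAlgebra' u w)) [𝔫.IsPrime], IsTHomogeneous u w 𝔫 → cobordantT' u w ∈ 𝔫 →
            (maximalIdeal S).map (algebraMap S (cobordantAlgebra' u w)) ≤ 𝔫 →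
            ¬ extReesAlgebra.vertexIdeal (weightedMonomialIdeal u w) ≤ 𝔫 →
            ∀ (a : ℕ) (g : cobordantAlgebra' u w), algebraMap S (cobordantAlgebra' u w) f = cobordantT' u w ^ a * g →
              ¬ cobordantT' u w ∣ g →
              algebraMap (cobordantAlgebra' u w) (Localization.AtPrime 𝔫) g ∈ maximalIdeal (Localization.AtPrime 𝔫) ^ 2 →
              iotaFlatT (Localization.AtPrime 𝔫) (algebraMap (cobordantAlgebra' u w) (Localization.AtPrime 𝔫) g) <
                iotaFlatT S f)
    (hCURVETIE : ∀ (k₀ : Type) [Field k₀] [CharP k₀ p] [PerfectField k₀]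
      (S : Type) [CommRing S] [Algebra k₀ S] [Algebra.EssFiniteType k₀ S] [IsRegularLocalRing S]
      (f : S), ringKrullDim S = 3 → f ≠ 0 → f ∈ (maximalIdeal S) ^ 2 →
      ∀ (P : Ideal S) [P.IsPrime], IsRegularLocalRing (S ⧸ P) → f ∈ P →
        topStratum iotaOrdEpsTau S f = {𝔮 | P ≤ 𝔮.asIdeal} → ¬ ringKrullDim (Localization.AtPrime P) ≤ 1 →
        P ≠ maximalIdeal S →
        ∀ (y x z : S) (b ν : ℕ), Ideal.span (Set.range ![y, x, z]) = maximalIdeal S → Ideal.span (Set.range ![y, x]) = P →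
          1 ≤ b → 1 ≤ ν → f ∈ maximalIdeal S ^ ν → f ∉ maximalIdeal S ^ (ν + 1) →
          f ∈ weightedMonomialIdeal ![y, x] ![b, 1] (b * ν) → (∀ m : ℕ, jFlatT S f m = weightedMonomialIdeal ![y, x] ![b, 1] m) →
          ((∃ lam : S, f ∈ weightedMonomialIdeal ![x, y - lam * x ^ b, z] ![1, b + 1, 1] ((b + 1) * ν)) ∨
            (b = 1 ∧ f ∈ weightedMonomialIdeal ![y, x, z] ![1, 2, 1] (2 * ν))) →
        ∀ (n : ℕ) (u : Fin n → S) (w : Fin n → ℕ),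
          Ideal.span (Set.range u) = maximalIdeal S → (maximalIdeal S).spanFinrank = n → (∃ i, 0 < w i) →
          Ideal.span {x | ∃ i, 0 < w i ∧ x = u i} = P →
          (∀ m : ℕ, weightedMonomialIdeal u w m = jFlatT S f m) →
          ∀ (𝔫 : Ideal (cobordantAlgebra' u w)) [𝔫.IsPrime], IsTHomogeneous u w 𝔫 → cobordantT' u w ∈ 𝔫 →
            (maximalIdeal S).map (algebraMap S (cobordantAlgebra' u w)) ≤ 𝔫 →
            ¬ extReesAlgebra.vertexIdeal (weightedMonomialIdeal u w) ≤ 𝔫 →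
            ∀ (a : ℕ) (g : cobordantAlgebra' u w), algebraMap S (cobordantAlgebra' u w) f = cobordantT' u w ^ a * g →
              ¬ cobordantT' u w ∣ g →
              algebraMap (cobordantAlgebra' u w) (Localization.AtPrime 𝔫) g ∈ maximalIdeal (Localization.AtPrime 𝔫) ^ 2 →
              iotaFlatT (Localization.AtPrime 𝔫) (algebraMap (cobordantAlgebra' u w) (Localization.AtPrime 𝔫) g) <
                iotaFlatT S f) :
    KeyRungGrHomLE 3 p :=
  keyRungGrHomLE_three_of_game p hD (canonicalGameClauseHomLE_three_of_point_curveTie p hPOINT hCURVETIE)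

/-- **GAP LIST OF RECORD, (c11)-form — (c11)≤3 + (D-b³-point) + (D-b³-curve-TIE).** [OURS · L1 W4.3 · audit glue] -/
theorem keyRungGrHomLE_three_of_c11_point_curveTie (p : ℕ) (hc11 : IotaJEssSmoothCompatibleLE 3 iotaFlatT jFlatT)
    (hPOINT : ∀ (k₀ : Type) [Field k₀] [CharP k₀ p] [PerfectField k₀]
      (S : Type) [CommRing S] [Algebra k₀ S] [Algebra.EssFiniteType k₀ S] [IsRegularLocalRing S]
      (f : S), ringKrullDim S = 3 → f ≠ 0 → f ∈ (maximalIdeal S) ^ 2 →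
      ∀ (P : Ideal S) [P.IsPrime], IsRegularLocalRing (S ⧸ P) → f ∈ P →
        topStratum iotaOrdEpsTau S f = {𝔮 | P ≤ 𝔮.asIdeal} → ¬ ringKrullDim (Localization.AtPrime P) ≤ 1 →
        P = maximalIdeal S →
        ∀ (n : ℕ) (u : Fin n → S) (w : Fin n → ℕ),
          Ideal.span (Set.range u) = maximalIdeal S → (maximalIdeal S).spanFinrank = n → (∃ i, 0 < w i) →
          Ideal.span {x | ∃ i, 0 < w i ∧ x = u i} = P →
          (∀ m : ℕ, weightedMonomialIdeal u w m = jFlatT S f m) →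
          ∀ (𝔫 : Ideal (cobordantAlgebra' u w)) [𝔫.IsPrime], IsTHomogeneous u w 𝔫 → cobordantT' u w ∈ 𝔫 →
            (maximalIdeal S).map (algebraMap S (cobordantAlgebra' u w)) ≤ 𝔫 →
            ¬ extReesAlgebra.vertexIdeal (weightedMonomialIdeal u w) ≤ 𝔫 →
            ∀ (a : ℕ) (g : cobordantAlgebra' u w), algebraMap S (cobordantAlgebra' u w) f = cobordantT' u w ^ a * g →
              ¬ cobordantT' u w ∣ g →
              algebraMap (cobordantAlgebra' u w) (Localization.AtPrime 𝔫) g ∈ maximalIdeal (Localization.AtPrime 𝔫) ^ 2 →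
              iotaFlatT (Localization.AtPrime 𝔫) (algebraMap (cobordantAlgebra' u w) (Localization.AtPrime 𝔫) g) <
                iotaFlatT S f)
    (hCURVETIE : ∀ (k₀ : Type) [Field k₀] [CharP k₀ p] [PerfectField k₀]
      (S : Type) [CommRing S] [Algebra k₀ S] [Algebra.EssFiniteType k₀ S] [IsRegularLocalRing S]
      (f : S), ringKrullDim S = 3 → f ≠ 0 → f ∈ (maximalIdeal S) ^ 2 →
      ∀ (P : Ideal S) [P.IsPrime], IsRegularLocalRing (S ⧸ P) → f ∈ P →
        topStratum iotaOrdEpsTau S f = {𝔮 | P ≤ 𝔮.asIdeal} → ¬ ringKrullDim (Localization.AtPrime P) ≤ 1 →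
        P ≠ maximalIdeal S →
        ∀ (y x z : S) (b ν : ℕ), Ideal.span (Set.range ![y, x, z]) = maximalIdeal S → Ideal.span (Set.range ![y, x]) = P →
          1 ≤ b → 1 ≤ ν → f ∈ maximalIdeal S ^ ν → f ∉ maximalIdeal S ^ (ν + 1) →
          f ∈ weightedMonomialIdeal ![y, x] ![b, 1] (b * ν) → (∀ m : ℕ, jFlatT S f m = weightedMonomialIdeal ![y, x] ![b, 1] m) →
          ((∃ lam : S, f ∈ weightedMonomialIdeal ![x, y - lam * x ^ b, z] ![1, b + 1, 1] ((b + 1) * ν)) ∨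
            (b = 1 ∧ f ∈ weightedMonomialIdeal ![y, x, z] ![1, 2, 1] (2 * ν))) →
        ∀ (n : ℕ) (u : Fin n → S) (w : Fin n → ℕ),
          Ideal.span (Set.range u) = maximalIdeal S → (maximalIdeal S).spanFinrank = n → (∃ i, 0 < w i) →
          Ideal.span {x | ∃ i, 0 < w i ∧ x = u i} = P →
          (∀ m : ℕ, weightedMonomialIdeal u w m = jFlatT S f m) →
          ∀ (𝔫 : Ideal (cobordantAlgebra' u w)) [𝔫.IsPrime], IsTHomogeneous u w 𝔫 → cobordantT' u w ∈ 𝔫 →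
            (maximalIdeal S).map (algebraMap S (cobordantAlgebra' u w)) ≤ 𝔫 →
            ¬ extReesAlgebra.vertexIdeal (weightedMonomialIdeal u w) ≤ 𝔫 →
            ∀ (a : ℕ) (g : cobordantAlgebra' u w), algebraMap S (cobordantAlgebra' u w) f = cobordantT' u w ^ a * g →
              ¬ cobordantT' u w ∣ g →
              algebraMap (cobordantAlgebra' u w) (Localization.AtPrime 𝔫) g ∈ maximalIdeal (Localization.AtPrime 𝔫) ^ 2 →
              iotaFlatT (Localization.AtPrime 𝔫) (algebraMap (cobordantAlgebra' u w) (Localization.AtPrime 𝔫) g) <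
                iotaFlatT S f) :
    KeyRungGrHomLE 3 p :=
  keyRungGrHomLE_three_of_c11_game p hc11 (canonicalGameClauseHomLE_three_of_point_curveTie p hPOINT hCURVETIE)

/-- **GAP LIST OF RECORD (named-pair form) — hD + (D-b³-point) + (D-b³-curve-TIE)**: `PRungGrHomLE 3 p iotaFlatT jFlatT`.
[OURS · L1 W4.3 · audit glue] -/
theorem pRungGrHomLE_three_of_tieDescent_point_curveTie (p : ℕ)
    (hD : ∀ (T T' : Type) [CommRing T] [IsRegularLocalRing T] [CommRing T'] [IsRegularLocalRing T'] [Algebra T T']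
      [IsLocalHom (algebraMap T T')] [Algebra.FormallySmooth T T'] [Algebra.EssFiniteType T T'] (g : T),
      ringKrullDim T' ≤ 3 → IsTiePosition T' (algebraMap T T' g) → IsTiePosition T g)
    (hPOINT : ∀ (k₀ : Type) [Field k₀] [CharP k₀ p] [PerfectField k₀]
      (S : Type) [CommRing S] [Algebra k₀ S] [Algebra.EssFiniteType k₀ S] [IsRegularLocalRing S]
      (f : S), ringKrullDim S = 3 → f ≠ 0 → f ∈ (maximalIdeal S) ^ 2 →
      ∀ (P : Ideal S) [P.IsPrime], IsRegularLocalRing (S ⧸ P) → f ∈ P →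
        topStratum iotaOrdEpsTau S f = {𝔮 | P ≤ 𝔮.asIdeal} → ¬ ringKrullDim (Localization.AtPrime P) ≤ 1 →
        P = maximalIdeal S →
        ∀ (n : ℕ) (u : Fin n → S) (w : Fin n → ℕ),
          Ideal.span (Set.range u) = maximalIdeal S → (maximalIdeal S).spanFinrank = n → (∃ i, 0 < w i) →
          Ideal.span {x | ∃ i, 0 < w i ∧ x = u i} = P →
          (∀ m : ℕ, weightedMonomialIdeal u w m = jFlatT S f m) →
          ∀ (𝔫 : Ideal (cobordantAlgebra' u w)) [𝔫.IsPrime], IsTHomogeneous u w 𝔫 → cobordantT' u w ∈ 𝔫 →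
            (maximalIdeal S).map (algebraMap S (cobordantAlgebra' u w)) ≤ 𝔫 →
            ¬ extReesAlgebra.vertexIdeal (weightedMonomialIdeal u w) ≤ 𝔫 →
            ∀ (a : ℕ) (g : cobordantAlgebra' u w), algebraMap S (cobordantAlgebra' u w) f = cobordantT' u w ^ a * g →
              ¬ cobordantT' u w ∣ g →
              algebraMap (cobordantAlgebra' u w) (Localization.AtPrime 𝔫) g ∈ maximalIdeal (Localization.AtPrime 𝔫) ^ 2 →
              iotaFlatT (Localization.AtPrime 𝔫) (algebraMap (cobordantAlgebra' u w) (Localization.AtPrime 𝔫) g) <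
                iotaFlatT S f)
    (hCURVETIE : ∀ (k₀ : Type) [Field k₀] [CharP k₀ p] [PerfectField k₀]
      (S : Type) [CommRing S] [Algebra k₀ S] [Algebra.EssFiniteType k₀ S] [IsRegularLocalRing S]
      (f : S), ringKrullDim S = 3 → f ≠ 0 → f ∈ (maximalIdeal S) ^ 2 →
      ∀ (P : Ideal S) [P.IsPrime], IsRegularLocalRing (S ⧸ P) → f ∈ P →
        topStratum iotaOrdEpsTau S f = {𝔮 | P ≤ 𝔮.asIdeal} → ¬ ringKrullDim (Localization.AtPrime P) ≤ 1 →
        P ≠ maximalIdeal S →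
        ∀ (y x z : S) (b ν : ℕ), Ideal.span (Set.range ![y, x, z]) = maximalIdeal S → Ideal.span (Set.range ![y, x]) = P →
          1 ≤ b → 1 ≤ ν → f ∈ maximalIdeal S ^ ν → f ∉ maximalIdeal S ^ (ν + 1) →
          f ∈ weightedMonomialIdeal ![y, x] ![b, 1] (b * ν) → (∀ m : ℕ, jFlatT S f m = weightedMonomialIdeal ![y, x] ![b, 1] m) →
          ((∃ lam : S, f ∈ weightedMonomialIdeal ![x, y - lam * x ^ b, z] ![1, b + 1, 1] ((b + 1) * ν)) ∨
            (b = 1 ∧ f ∈ weightedMonomialIdeal ![y, x, z] ![1, 2, 1] (2 * ν))) →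
        ∀ (n : ℕ) (u : Fin n → S) (w : Fin n → ℕ),
          Ideal.span (Set.range u) = maximalIdeal S → (maximalIdeal S).spanFinrank = n → (∃ i, 0 < w i) →
          Ideal.span {x | ∃ i, 0 < w i ∧ x = u i} = P →
          (∀ m : ℕ, weightedMonomialIdeal u w m = jFlatT S f m) →
          ∀ (𝔫 : Ideal (cobordantAlgebra' u w)) [𝔫.IsPrime], IsTHomogeneous u w 𝔫 → cobordantT' u w ∈ 𝔫 →
            (maximalIdeal S).map (algebraMap S (cobordantAlgebra' u w)) ≤ 𝔫 →
            ¬ extReesAlgebra.vertexIdeal (weightedMonomialIdeal u w) ≤ 𝔫 →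
            ∀ (a : ℕ) (g : cobordantAlgebra' u w), algebraMap S (cobordantAlgebra' u w) f = cobordantT' u w ^ a * g →
              ¬ cobordantT' u w ∣ g →
              algebraMap (cobordantAlgebra' u w) (Localization.AtPrime 𝔫) g ∈ maximalIdeal (Localization.AtPrime 𝔫) ^ 2 →
              iotaFlatT (Localization.AtPrime 𝔫) (algebraMap (cobordantAlgebra' u w) (Localization.AtPrime 𝔫) g) <
                iotaFlatT S f) :
    PRungGrHomLE 3 p iotaFlatT jFlatT :=
  pRungGrHomLE_three_of_tieDescent_game p hD (canonicalGameClauseHomLE_three_of_point_curveTie p hPOINT hCURVETIE)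

end Summit.ResolutionOfSingularities.ResolutionOfSingularities.Cruxes.HypersurfaceCentreConstruction.LocalEngine

end
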